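/-
Copyright: statement-level skeleton of a published paper (lit-balaban cell, Phase-2 proof seat p37 gen 106). No claims beyond
what the kernel checks below.
-/
import Literature.MathematicalPhysics.QuantumFieldTheory.Balaban1983to89.B3OnePIPictureCensus

/-!
# B3 — T. Bałaban, *(Higgs)₂,₃ quantum fields in a finite volume. III. Renormalization*, CMP **88** (1983) 411–445
[Balaban1983Higgs3] — p. 415 [PDF 5] *"connected in the usual sense"* and p. 416 [PDF 6] *"one-particle-irreducible graphs"*:
the predicates `IsConnected`, `IsConnectedOff`, `IsOnePI`, `IsProper` of `B3OnePIGraphs` on the concrete graph model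
`B3Cor23Concrete.Graph` (p18) are DECIDABLE — COMPLETENESS of the Boolean deciders `reachB` / `connB` / `onePIBOf` / `properBOf`

statement-level skeleton of published theorems with citation tags; proofs where landed; nothing here is a claim about
the Yang–Mills mass gap

PDF held: `paper:balaban1983-higgs-2-3-quantum-fields-finite-volume` (journal page = PDF page + 410); pp. 415–416 read in the
text layer (`p0005.txt`, `p0006.txt` of `lit read`) and on the ×2 renders `run/shared/lean/pub/pub-balaban/b2b-balaban-ref1/pages/
1983-cmp88-higgs23-III/1983-cmp88-higgs23-III-p005, p006-x2.png`.

CITATION HEADER (lean-in-tree rule).  lit-balaban TYPED SKELETON (HOME `run/shared/lean/pub/lit-balaban/`), PHASE 2, seat p37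
gen 106 (unit `lit-balaban-p37`; TAKING line HOME/STATUS.md 2026-08-23T10:15:46Z), fifth file (FILE E) of BRICK 3 of the owner
r15's HQ25 programme for row **B3.Eq1.19-1.22** of `HOME/lit-balaban-r15/ROWS-B3.md` (fold owner r15, referee ref-4; lead g12
HEAD WORD Q25 2026-08-23T08:24:18Z: bricks WELCOME as located members, zero head weight).  Sibling of `B3OnePIGraphs`
(`reachB`, `connB`, `onePIBOf`, `properBOf` with SOUNDNESS `reflTransGen_of_reachB`, `forall_reflTransGen_of_connB`,
`isOnePI_of_onePIBOf`, `isProper_of_properBOf`; the predicates `IsConnected`, `IsConnectedOff`, `IsOnePI`, `IsProper`),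
`B3OnePIPictureCensus`, `B3OnePIBridge`, `B3OnePIBridgeOrder` (same seat, gen 105).  REUSED BY NAME, nothing re-declared.

THE PRINTED TEXT (verbatim).  p. 415: *"Now a graph for us is a collection of internal lines, external legs, and vertices
connected in the usual sense. There is at least one internal line, and every internal line has a vertex at each endpoint."*
p. 416: *"… where C₀^ε = (−Δ₀^ε + m²)^{−1} and Σ^ε, Σ₁^ε, Σ₂^ε are given by amputated, one-particle-irreducible graphs of the
expansion of G^ε."*  (Print uses both notions as properties one reads off a drawn graph; this file records that, on the model,
they are decidable — the kernel can read them off any closed graph term.)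

WHAT IS PROVED (theorems + four `Decidable` instances; no new predicate, no `Prop` fact, no `sorry`; standard axioms).
§1 COMPLETENESS OF `reachB` on `Fin m` for a decidable relation `P`: `reachB_mono`/`reachB_mono_le` (the reach sets
S_n(i) = {j | reachB P n i j} grow with n), `reachB_self`, `reachB_step`; **`reachB_complete_of_stable`** (if S_{n+1}(i) = S_n(i)
then S_n(i) is closed under `P`, hence contains every `j` with `ReflTransGen P i j`); `card_reachSet_lt_succ` (while some
reachable `j` is missed, the reach set grows STRICTLY); `succ_le_card_reachSet` (so it has ≥ n + 1 elements at step n while `j` is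
missed); **`reachB_complete`**: for `m ≤ n + 1`, `ReflTransGen P i j → reachB P n i j = true` (a missed `j` would force ≥ m
elements into a set avoiding `j`); **`reflTransGen_iff_reachB`**.
§2 ON THE MODEL, for `G : Graph n̄` with `G.nV` vertices: **`isConnected_iff_connB`** (`IsConnected G ↔ connB (Adj G) G.nV`),
**`isConnectedOff_iff_connB`**, **`isOnePI_iff_onePIBOf`** (`IsOnePI G ↔ onePIBOf G.other G.nV`), **`isProper_iff_properBOf`**,
and the instances `instDecidableIsConnected`, `instDecidableIsConnectedOff`, `instDecidableIsOnePI`, `instDecidableIsProper`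
(via `decidable_of_iff`; no `native_decide` anywhere).
§3 CLOSED INSTANCES RE-DECIDED BY `decide` through the instances, at n̄ = 13 (p. 418 l. 1: the paper takes n̄ > 12): the (1.22)
pictures ⑥ `g318g 13` and ⑦ `g122g 13` are 1PI; the non-examples of `B3OnePIPictureCensus` — `chain77 13` connected, not
proper, not 1PI; `hang18 13` proper, not 1PI; `tadpoles2 13` not connected — now WITHOUT hand-written separation certificates.
HONEST SCOPE.  Decidability/completeness only; the n̄-parametric pictures of the tree are still decided through the
structure-literal soundness lemmas `isOnePI_mk` etc. of `B3OnePIGraphs` (`decide` needs closed terms); nothing analytic.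
-/

namespace Literature.MathematicalPhysics.QuantumFieldTheory.Balaban1983to89.B3OnePIDecide

open Relation Finset B3Prop1 B3Cor23Concrete B3OnePIGraphs

/-! ## §1 Completeness of the Boolean reachability decider `reachB` -/

section Deciders

variable {m : ℕ} {P : Fin m → Fin m → Prop} [DecidableRel P]

/-- kernel: one more step never loses a reached vertex (S_n ⊆ S_{n+1}). [cite: Balaban1983Higgs3, p.415] -/
theorem reachB_mono {n : ℕ} {i j : Fin m} (h : reachB P n i j = true) : reachB P (n + 1) i j = true := by
  simp [reachB, h]

/-- kernel: the reach sets grow with the step bound. [cite: Balaban1983Higgs3, p.415] -/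
theorem reachB_mono_le {n n' : ℕ} (hn : n ≤ n') {i j : Fin m} (h : reachB P n i j = true) : reachB P n' i j = true := by
  induction hn with
  | refl => exact h
  | step _ ih => exact reachB_mono ih

/-- kernel: every vertex reaches itself in any number of steps. [cite: Balaban1983Higgs3, p.415] -/
theorem reachB_self (n : ℕ) (i : Fin m) : reachB P n i i = true :=
  reachB_mono_le (Nat.zero_le n) (by simp [reachB])

/-- kernel: a reached vertex followed by one `P`-step is reached with one more step. [cite: Balaban1983Higgs3, p.415] -/
theorem reachB_step {n : ℕ} {i k j : Fin m} (hk : reachB P n i k = true) (hkj : P k j) : reachB P (n + 1) i j = true := by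
  simp only [reachB, Bool.or_eq_true, decide_eq_true_eq]
  exact Or.inr ⟨k, hk, hkj⟩

/-- **stabilisation ⇒ completeness**: if the step n + 1 reaches nothing new from `i`, the vertices reached in `n` steps form a
set closed under `P` containing `i`, hence contain every `j` with `ReflTransGen P i j`. [cite: Balaban1983Higgs3, p.415] -/
theorem reachB_complete_of_stable {n : ℕ} {i : Fin m}
    (hst : ∀ j, reachB P (n + 1) i j = true → reachB P n i j = true) {j : Fin m} (h : ReflTransGen P i j) :
    reachB P n i j = true := by
  induction h with
  | refl => exact reachB_self n i
  | tail _ hab ih => exact hst _ (reachB_step ih hab)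

/-- kernel: while some `j` with `ReflTransGen P i j` is still missed at step `n`, the reach set grows STRICTLY from step `n` to
step `n + 1` (otherwise it would be stable, hence complete). [cite: Balaban1983Higgs3, p.415] -/
theorem card_reachSet_lt_succ {n : ℕ} {i j : Fin m} (hj : ReflTransGen P i j) (hjn : reachB P n i j = false) :
    (univ.filter fun k => reachB P n i k = true).card < (univ.filter fun k => reachB P (n + 1) i k = true).card := by
  apply card_lt_card
  refine (ssubset_iff_of_subset ?_).2 ?_
  · intro k hk
    simp only [mem_filter, mem_univ, true_and] at hk ⊢
    exact reachB_mono hk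
  · by_contra hcon
    push Not at hcon
    have hst : ∀ k, reachB P (n + 1) i k = true → reachB P n i k = true := fun k hk => by
      have := hcon k (by simpa using hk)
      simpa using this
    have := reachB_complete_of_stable hst hj
    simp [this] at hjn

/-- kernel: hence, while `j` is missed at step `n`, at least `n + 1` vertices are reached at step `n`.
[cite: Balaban1983Higgs3, p.415] -/
theorem succ_le_card_reachSet {i j : Fin m} (hj : ReflTransGen P i j) :
    ∀ n : ℕ, reachB P n i j = false → n + 1 ≤ (univ.filter fun k => reachB P n i k = true).card
  | 0, _ => by
      apply Nat.succ_le_of_lt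
      apply card_pos.2
      exact ⟨i, by simp [reachB_self]⟩
  | n + 1, h => by
      have h' : reachB P n i j = false := by
        cases hn : reachB P n i j with
        | false => rfl
        | true => simp [reachB_mono hn] at h
      exact Nat.succ_le_of_lt (lt_of_le_of_lt (succ_le_card_reachSet hj n h') (card_reachSet_lt_succ hj h'))

/-- **COMPLETENESS of `reachB`**: on `Fin m`, with a step bound `n ≥ m − 1`, the Boolean decider reaches every `j` with
`ReflTransGen P i j` (a missed `j` would force `n + 1 ≥ m` reached vertices into `Fin m` minus `j`).
[cite: Balaban1983Higgs3, p.415] -/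
theorem reachB_complete {n : ℕ} (hn : m ≤ n + 1) {i j : Fin m} (h : ReflTransGen P i j) : reachB P n i j = true := by
  by_contra hne
  have hf : reachB P n i j = false := by simpa using hne
  have hcard := succ_le_card_reachSet h n hf
  have hsub : (univ.filter fun k => reachB P n i k = true) ⊆ univ.erase j := by
    intro k hk
    simp only [mem_filter, mem_univ, true_and] at hk
    refine mem_erase.2 ⟨?_, mem_univ _⟩
    rintro rfl
    simp [hk] at hf
  have := (card_le_card hsub).trans_eq (card_erase_of_mem (mem_univ j))
  simp only [card_univ, Fintype.card_fin] at this
  omega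

/-- **the reflexive–transitive closure of a decidable relation on `Fin m` is computed by `reachB` with any step bound
`n ≥ m − 1`** (soundness `B3OnePIGraphs.reflTransGen_of_reachB` + completeness `reachB_complete`). [cite: Balaban1983Higgs3, p.415] -/
theorem reflTransGen_iff_reachB {n : ℕ} (hn : m ≤ n + 1) {i j : Fin m} :
    ReflTransGen P i j ↔ reachB P n i j = true :=
  ⟨reachB_complete hn, reflTransGen_of_reachB n i j⟩

/-- kernel: `connB P n` with `n ≥ m − 1` decides "every vertex reaches every vertex". [cite: Balaban1983Higgs3, p.415] -/
theorem forall_reflTransGen_iff_connB {n : ℕ} (hn : m ≤ n + 1) :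
    (∀ i j : Fin m, ReflTransGen P i j) ↔ connB P n = true := by
  simp only [connB, decide_eq_true_eq]
  exact forall_congr' fun i => forall_congr' fun j => reflTransGen_iff_reachB hn

end Deciders

/-! ## §2 The predicates of `B3OnePIGraphs` are decidable on the model -/

section Model

variable {nbar : ℕ} (G : Graph nbar)

/-- **p. 415 *"connected in the usual sense"* is decidable on the model**: `IsConnected G` holds iff the Boolean check `connB`
with step bound the number of vertices succeeds. [cite: Balaban1983Higgs3, p.415] -/
theorem isConnected_iff_connB : IsConnected G ↔ connB (Adj G) G.nV = true :=
  forall_reflTransGen_iff_connB (Nat.le_succ _)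

/-- kernel: connectedness after cutting the line through `c` is decided by `connB` on the cut adjacency.
[cite: Balaban1983Higgs3, (1.21) p.416] -/
theorem isConnectedOff_iff_connB (c : Leg G.kind) : IsConnectedOff G c ↔ connB (AdjOff G c) G.nV = true :=
  forall_reflTransGen_iff_connB (Nat.le_succ _)

/-- **p. 416 *"one-particle-irreducible"* is decidable on the model**: `IsOnePI G` holds iff the Boolean check `onePIBOf` on
the line data of `G`, with step bound the number of vertices, succeeds (soundness is `B3OnePIGraphs.isOnePI_of_onePIBOf`).
[cite: Balaban1983Higgs3, (1.21) p.416] -/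
theorem isOnePI_iff_onePIBOf : IsOnePI G ↔ onePIBOf G.other G.nV = true := by
  refine ⟨fun h => ?_, isOnePI_of_onePIBOf⟩
  simp only [onePIBOf, Bool.and_eq_true, decide_eq_true_eq]
  exact ⟨(isConnected_iff_connB G).1 h.1, fun c hc => (isConnectedOff_iff_connB G c).1 (h.2 c hc)⟩

/-- kernel: the channel variant `IsProper G` is decided by `properBOf` with step bound the number of vertices (soundness is
`B3OnePIGraphs.isProper_of_properBOf`). [cite: Balaban1983Higgs3, (1.21) p.416] -/
theorem isProper_iff_properBOf : IsProper G ↔ properBOf G.other G.nV = true := by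
  refine ⟨fun h => ?_, isProper_of_properBOf⟩
  simp only [properBOf, Bool.and_eq_true, decide_eq_true_eq]
  exact ⟨(isConnected_iff_connB G).1 h.1,
    fun c hc x₁ x₂ e₁ e₂ => reachB_complete (Nat.le_succ _) (h.2 c hc x₁ x₂ e₁ e₂)⟩

/-- `IsConnected G` is decidable (p. 415's notion, read off the line data by the kernel). [cite: Balaban1983Higgs3, p.415] -/
instance instDecidableIsConnected : Decidable (IsConnected G) :=
  decidable_of_iff _ (isConnected_iff_connB G).symm

/-- `IsConnectedOff G c` is decidable. [cite: Balaban1983Higgs3, (1.21) p.416] -/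
instance instDecidableIsConnectedOff (c : Leg G.kind) : Decidable (IsConnectedOff G c) :=
  decidable_of_iff _ (isConnectedOff_iff_connB G c).symm

/-- `IsOnePI G` is decidable (p. 416's "one-particle-irreducible", read off the line data by the kernel).
[cite: Balaban1983Higgs3, (1.21) p.416] -/
instance instDecidableIsOnePI : Decidable (IsOnePI G) :=
  decidable_of_iff _ (isOnePI_iff_onePIBOf G).symm

/-- `IsProper G` is decidable. [cite: Balaban1983Higgs3, (1.21) p.416] -/
instance instDecidableIsProper : Decidable (IsProper G) :=
  decidable_of_iff _ (isProper_iff_properBOf G).symm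

variable {G}

/-- kernel: the negative decisions are complete too — a graph of the model that is not connected fails `connB` at the
vertex bound. [cite: Balaban1983Higgs3, p.415] -/
theorem connB_eq_false_of_not_isConnected (h : ¬ IsConnected G) : connB (Adj G) G.nV = false := by
  simpa [isConnected_iff_connB] using h

/-- kernel: a graph of the model that is not one-particle-irreducible fails `onePIBOf` at the vertex bound.
[cite: Balaban1983Higgs3, (1.21) p.416] -/
theorem onePIBOf_eq_false_of_not_isOnePI (h : ¬ IsOnePI G) : onePIBOf G.other G.nV = false := by
  simpa [isOnePI_iff_onePIBOf] using h

/-- kernel: a graph of the model that is not proper fails `properBOf` at the vertex bound. [cite: Balaban1983Higgs3, (1.21) p.416] -/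
theorem properBOf_eq_false_of_not_isProper (h : ¬ IsProper G) : properBOf G.other G.nV = false := by
  simpa [isProper_iff_properBOf] using h

end Model

/-! ## §3 The kernel re-decides closed pictures through the instances (n̄ = 13, the paper's n̄ > 12 of p. 418) -/

section Closed

/-- kernel, by `decide` through `instDecidableIsOnePI`: the sunset ⑥ of (1.22) (p18's `g318g`) at n̄ = 13 is 1PI.
[cite: Balaban1983Higgs3, (1.22) p.416] -/
theorem isOnePI_g318g_thirteen : IsOnePI (B3Sect3Graphs318.g318g 13) := by
  decide

/-- kernel, by `decide`: the three-vertex picture ⑦ of (1.22) (p18's `g122g`) at n̄ = 13 is 1PI.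
[cite: Balaban1983Higgs3, (1.22) p.416] -/
theorem isOnePI_g122g_thirteen : IsOnePI (B3Sect1Graphs122.g122g 13 (by decide)) := by
  decide

/-- kernel, by `decide` (a NEGATIVE decision without a hand-written separation certificate): the two-insertion chain
•δm²—•δm² (`B3OnePIPictureCensus.chain77`) at n̄ = 13 is connected, not proper, not 1PI. [cite: Balaban1983Higgs3, (1.21) p.416] -/
theorem chain77_thirteen_decided :
    IsConnected (B3OnePIPictureCensus.chain77 13) ∧ ¬ IsProper (B3OnePIPictureCensus.chain77 13) ∧
      ¬ IsOnePI (B3OnePIPictureCensus.chain77 13) := by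
  decide

/-- kernel, by `decide`: the graph with a part hanging by one A′-line away from the channel (`B3OnePIPictureCensus.hang18`) at
n̄ = 13 is proper but not 1PI — the two notions differ, decided without certificates. [cite: Balaban1983Higgs3, (1.21) p.416] -/
theorem hang18_thirteen_decided :
    IsProper (B3OnePIPictureCensus.hang18 13 (by decide)) ∧ ¬ IsOnePI (B3OnePIPictureCensus.hang18 13 (by decide)) := by
  decide

/-- kernel, by `decide`: two tadpoles side by side (`B3OnePIPictureCensus.tadpoles2`) at n̄ = 13 are not a connected graph.
[cite: Balaban1983Higgs3, p.415] -/
theorem not_isConnected_tadpoles2_thirteen : ¬ IsConnected (B3OnePIPictureCensus.tadpoles2 13) := by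
  decide

end Closed

end Literature.MathematicalPhysics.QuantumFieldTheory.Balaban1983to89.B3OnePIDecide
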